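import Summits.Ventures.LatticeQCDFlow.TrivializingMaps.CouplingKLAnyGroup

/-!
HONEST FRAMING: exact (Metropolis-corrected) sampling algorithms for lattice gauge theory; figures
of merit are autocorrelation/cost numbers at stated couplings and volumes; no continuum-physics
claim.

# CouplingESSAnyGroup — THE MEASURE-LEVEL `ESS ≤ e^{−KL}` LAW FOR EXACT REWEIGHTING BETWEEN COUPLINGS:
# `log E_{μ_a}[(dμ_b/dμ_a)²] ≥ D(μ_b ‖ μ_a)`, EVERY COMPACT GAUGE GROUP, ALL REAL `a, b`
# (lean-2 GEN-10, ours)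

Venture-side (OURS).  Cell `lqcd-flow` (pub-lqcd), unit `pub-lqcd-lean-2-g10`, 2026-08-23.  The venture's
first formalised law was V1, `ESS/N ≤ exp(−D_KL(p‖q))` for FINITE state spaces (`Scaling/ImportanceWeights`,
lean-2 GEN-1).  For the one-parameter Wilson family `μ_t = wilsonMeasure ρ t` of ANY compact gauge group
the same law holds at MEASURE level and in closed form: with `ψ = cgf(−S_W^ρ)` (convex, `ψ′ = −⟨S_W⟩`,
`ψ″ = Var`), one exact reweighting step `a → b` has weight `w = dμ_b/dμ_a`,
`E_{μ_a}[w²] = exp(ψ(2b−a) − 2ψ(b) + ψ(a))` (GEN-8 `weight_sq_integral_eq_anyGroup`, `δ = b − a`) and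
`D(μ_b ‖ μ_a) = ψ(a) − ψ(b) − (a − b)·ψ′(b)` (`CouplingKLAnyGroup`), so the law is the convexity
inequality `ψ(2b−a) − ψ(b) ≥ (b−a)·ψ′(b)` (tangent below chord):

* `mul_deriv_le_cgf_sub_all` — `δ·ψ′(c) ≤ ψ(c+δ) − ψ(c)` for EVERY real `δ` (both signs);
* **`klDiv_le_log_weight_sq`** — `D(μ_b ‖ μ_a) ≤ ψ(a + 2(b−a)) − 2ψ(a + (b−a)) + ψ(a) = log E_{μ_a}[w²]`
  for all real `a, b` (heating or cooling), every compact `G`, every volume;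
* **`inv_weight_sq_le_exp_neg_klDiv`** — the asymptotic ESS fraction of the step,
  `1/E_{μ_a}[w²] ≤ exp(−D(μ_b ‖ μ_a))`: V1 at measure level for lattice gauge theory;
* **`klDiv_le_volume_step`** — hence with `AnnealingSufficiencyAnyGroup`: `D(μ_b‖μ_a) ≤ log E[w²] ≤
  2N·#plaq·(b − a)` for `a ≤ b` (the KL currency is never more expensive than the `χ²` currency).

NOT CLAIMED: finite-sample ESS; the reverse inequality (`log E[w²]` can exceed `D` by the variance
term — Rényi-2 vs Rényi-1); acceptance rates; anything about flows or the continuum.  Literature grade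
(cell rule): elementary (`D₂ ≥ D₁` for Rényi divergences / Jensen; e.g. van Erven–Harremoës 2014 Thm 3);
new typing.
-/

noncomputable section

open MeasureTheory ProbabilityTheory Set intervalIntegral InformationTheory
open Literature.MathematicalPhysics.QuantumFieldTheory
open Literature.MathematicalPhysics.QuantumFieldTheory.Luscher2010
open scoped Matrix Matrix.Norms.Frobenius ContDiff

namespace Summit.Ventures.LatticeQCDFlow.TrivializingMaps

section AnyGroup

variable {d L N : ℕ} [NeZero L] {G : Type*} [Group G] [TopologicalSpace G] [IsTopologicalGroup G]
  [CompactSpace G] [MeasurableSpace G] [BorelSpace G] [SecondCountableTopology G]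
  (ρ : G →* Matrix (Fin N) (Fin N) ℂ)

/-- **Tangent below the graph, both signs**: `δ·ψ′(c) ≤ ψ(c+δ) − ψ(c)` for every real `δ`
(`ψ = cgf(−S_W^ρ)` is convex: `ψ′` monotone). [folklore] -/
theorem mul_deriv_le_cgf_sub_all (hρ : Continuous ρ) (c δ : ℝ) :
    δ * deriv (cgf (fun U => -wilsonAction ρ U) (trivialMeasure G d L)) c ≤
      cgf (fun U => -wilsonAction ρ U) (trivialMeasure G d L) (c + δ) -
        cgf (fun U => -wilsonAction ρ U) (trivialMeasure G d L) c := by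
  rcases le_or_gt 0 δ with hδ | hδ
  · exact mul_deriv_le_cgf_sub (d := d) (L := L) ρ hρ hδ c
  · -- `δ < 0`: apply the upper chord on `[c+δ, c]`: `ψ(c) − ψ(c+δ) ≤ (−δ)·ψ′(c)`
    have h := cgf_sub_le_mul_deriv (d := d) (L := L) ρ hρ (δ := -δ) (by linarith) (c + δ)
    rw [show c + δ + -δ = c by ring] at h
    linarith

/-- **`D(μ_b ‖ μ_a) ≤ ψ(a + 2(b−a)) − 2ψ(a + (b−a)) + ψ(a)`** (`= log E_{μ_a}[(dμ_b/dμ_a)²]`, GEN-8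
`weight_sq_integral_eq_anyGroup` with `δ = b − a`) for ALL real `a, b`, every compact gauge group.
[ours] -/
theorem klDiv_le_log_weight_sq (hρ : Continuous ρ) (a b : ℝ) :
    (klDiv (wilsonMeasure (d := d) (L := L) ρ b) (wilsonMeasure (d := d) (L := L) ρ a)).toReal ≤
      cgf (fun U => -wilsonAction ρ U) (trivialMeasure G d L) (a + 2 * (b - a)) -
        2 * cgf (fun U => -wilsonAction ρ U) (trivialMeasure G d L) (a + (b - a)) +
        cgf (fun U => -wilsonAction ρ U) (trivialMeasure G d L) a := by
  rw [toReal_klDiv_wilsonMeasure_eq_bregman ρ hρ b a]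
  have h := mul_deriv_le_cgf_sub_all (d := d) (L := L) ρ hρ b (b - a)
  rw [show a + 2 * (b - a) = b + (b - a) by ring, show a + (b - a) = b by ring]
  linarith

/-- **THE WEIGHT SECOND MOMENT DOMINATES `e^{KL}`**:
`exp(D(μ_b ‖ μ_a)) ≤ E_{μ_a}[(dμ_b/dμ_a)²] = ∫ (e^{−(b−a)S} Z(a)/Z(b))² dμ_a`. [ours] -/
theorem exp_klDiv_le_weight_sq (hρ : Continuous ρ) (a b : ℝ) :
    Real.exp ((klDiv (wilsonMeasure (d := d) (L := L) ρ b) (wilsonMeasure (d := d) (L := L) ρ a)).toReal) ≤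
      ∫ U, (Real.exp (-((b - a) * wilsonAction ρ U)) *
        (mgf (fun U => -wilsonAction ρ U) (trivialMeasure G d L) a /
          mgf (fun U => -wilsonAction ρ U) (trivialMeasure G d L) (a + (b - a)))) ^ 2
      ∂(wilsonMeasure (d := d) (L := L) ρ a) := by
  rw [weight_sq_integral_eq_anyGroup hρ a (b - a)]
  exact Real.exp_le_exp.2 (klDiv_le_log_weight_sq (d := d) (L := L) ρ hρ a b)

/-- **V1 AT MEASURE LEVEL — `ESS ≤ e^{−KL}` FOR ONE EXACT REWEIGHTING STEP BETWEEN COUPLINGS**: the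
asymptotic effective-sample-size fraction `1/E_{μ_a}[w²]` of the step `a → b` is at most
`exp(−D(μ_b ‖ μ_a))`, every compact gauge group, all real `a, b`, every volume. [ours] -/
theorem inv_weight_sq_le_exp_neg_klDiv (hρ : Continuous ρ) (a b : ℝ) :
    (∫ U, (Real.exp (-((b - a) * wilsonAction ρ U)) *
        (mgf (fun U => -wilsonAction ρ U) (trivialMeasure G d L) a /
          mgf (fun U => -wilsonAction ρ U) (trivialMeasure G d L) (a + (b - a)))) ^ 2
      ∂(wilsonMeasure (d := d) (L := L) ρ a))⁻¹ ≤
      Real.exp (-(klDiv (wilsonMeasure (d := d) (L := L) ρ b) (wilsonMeasure (d := d) (L := L) ρ a)).toReal) := by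
  have h := exp_klDiv_le_weight_sq (d := d) (L := L) ρ hρ a b
  have hpos : 0 < Real.exp ((klDiv (wilsonMeasure (d := d) (L := L) ρ b)
      (wilsonMeasure (d := d) (L := L) ρ a)).toReal) := Real.exp_pos _
  rw [Real.exp_neg]
  exact inv_anti₀ hpos h

/-- **KL IS THE CHEAPER CURRENCY**: for `a ≤ b`,
`D(μ_b ‖ μ_a) ≤ log E_{μ_a}[w²] ≤ 2N·#plaq·(b − a)` (`cgf_second_difference_le_volume`). [ours] -/
theorem klDiv_le_volume_step (hρ : Continuous ρ) {a b : ℝ} (hab : a ≤ b) :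
    (klDiv (wilsonMeasure (d := d) (L := L) ρ b) (wilsonMeasure (d := d) (L := L) ρ a)).toReal ≤
      2 * N * Fintype.card (Plaquette d L) * (b - a) := by
  refine (klDiv_le_log_weight_sq (d := d) (L := L) ρ hρ a b).trans ?_
  have h := cgf_second_difference_le_volume (d := d) (L := L) ρ hρ (β := a) (δ := b - a)
    (sub_nonneg.2 hab)
  exact h

end AnyGroup

end Summit.Ventures.LatticeQCDFlow.TrivializingMaps

end
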